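import Literature.NumberTheory.EllipticCurves.ArtinMilneShaDecomposition
import Literature.NumberTheory.EllipticCurves.Rank1Residual.Typed.Basic
import HarnessLib

/-!
# Route `AdditiveKolyvaginRoad`: ONE-SIDED ARTIN–MILNE DESCENT ALONG A QUADRATIC BASE CHANGE — the lower (Eisenstein) half of
# `BSD_p` over `ℚ` from the lower half over an AUXILIARY quadratic field and the upper (Euler-system) half of the partner twist
# (input half of the over-`ℚ` socket of crux card `parahoric-ordinary-type-engine` on KS′ `LevelKolyvaginSystemsAdditive`,
# item stmt-BirchSwinnertonDyer-21396; cell `pub/bsd-wall`, width seat `bsd-wall-akr-p2x-w4` g4; `--supports` 21396, helper)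

THEOREMS ONLY (no definition, no named fact, no `sorry`).  CONDITIONAL on the displayed named fact
`Milne1972.bsdQuotientP_baseChange_relQuadratic_anyModel` (Dokchitser–Dokchitser 2010 Thm. 2.3, `p`-part, in Milne's
restriction-of-scalars form; a `def … : Prop` of the tree, not proved here) and on every displayed half of `BSD_p`; nothing about
any curve is asserted.  BSD is not proved by any of this; KS′ and KPA′ stay OPEN at `p² ∣ N`.

THE POINT.  Eisenstein-congruence ENGINES for the research residual of the Kolyvagin cruxes that run over an AUXILIARY imaginary
quadratic field `K″` (card `Cruxes/LevelKolyvaginSystemsAdditive/Ideas/parahoric-ordinary-type-engine.md`: Wan's `U(3,1)` method at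
parahoric type level; its typed deliverable `EngineRankZeroPairDeliverable` ends in `BSDpLowerOver (W₀.baseChange K″) p` =
«`Ш(E₀/K″)[p^∞]` finite, `#Ш_an(E₀/K″) ∈ ℚ`, `ord_p #Ш_an(E₀/K″) ≤ ord_p #Ш(E₀/K″)[p^∞]`») must RE-ENTER over `ℚ`, because the
landing socket on the crux (width seat akr-p2x-w5's `AdditiveKoly.exists_kolyvaginClass_ne_zero_of_lowerHalves`, p638284)
consumes the lower halves `Typed.MissingLowerBoundAt` of `BSD_p` over `ℚ` for `E` and for the minimal models of `E^{(d_K)}`.  The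
card names the re-entry («`ArtinMilneShaDecomposition` ∕ `bsdQuotientP_baseChange_relQuadratic_anyModel` (socket)») but a one-sided
inequality for `E/K″` does NOT split into one-sided inequalities for `E` and `E^{(c)}` by itself: it needs the OPPOSITE (Euler-system
∕ Kato, Kim–Nakamura at additive `p`) half for the partner.  This file is that bookkeeping — the one-layer identity `δ_p(E_K) = δ_p(E) + δ_p(E^{(c)})`,
`δ_p(X) = ord_p #Ш_an(X) − ord_p #Ш(X)[p^∞]` (the tree's `SolventPairLowerBound.padicValRat_analyticSha_quadratic`, route `TameQuarticSolvent`,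
re-derived here from Literature only so that this file sits in no route's cone) read ONE-SIDEDLY:

* §1 `analyticSha_baseChange_quadratic_mul` — the product identity `#Ш_an(E_K)·r·#Ш(E)[p^∞]·#Ш(E^{(c)})[p^∞] =
  #Ш(E_K)[p^∞]·#Ш_an(E)·#Ш_an(E^{(c)})` with `r ∈ ℚˣ`, `ord_p r = 0`, and the two RATIONALITY DESCENTS it yields: `#Ш_an(E) ∈ ℚ`
  from `#Ш_an(E_K), #Ш_an(E^{(c)}) ∈ ℚ` (`exists_shaAn_eq_of_baseChange_of_twist`) and symmetrically for the twist
  (`exists_shaAn_twist_eq_of_baseChange`) — the existing lemma ASSUMES rationality over `ℚ`; an engine over `K″` delivers it over `K″`.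
* §2 `padicValRat_delta_quadratic` — `δ_p(VK) = δ_p(W) + δ_p(Wc)` for any rational values of the three `#Ш_an`;
  `padicValRat_shaAn_le_of_lowerBaseChange_of_upperTwist` — LOWER over `K` + UPPER for `E^{(c)}` ⟹ LOWER for `E`
  (in the `Ш[p^∞]` currency of `BSDpOver`), and `padicValRat_shaAn_twist_le_of_lowerBaseChange_of_upper` (roles swapped).
* §3 `missingLowerBoundAt_of_lowerBaseChange_of_missingUpperBoundAt_twist` — the same in Miller's currency
  (`Typed.MissingLowerBoundAt ∕ MissingUpperBoundAt`, full orders `#Ш`) when `Ш(E)`, `Ш(E^{(c)})` are finite (analytic rank `≤ 1`),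
  and the swapped form — exactly the hypothesis shape `hlow ∕ hlowTw` of `exists_kolyvaginClass_ne_zero_of_lowerHalves`.

References: Dokchitser–Dokchitser, Ann. of Math. 172 (2010) Thm. 2.3; Milne, Invent. Math. 17 (1972) Thm. 1; Miller, LMS JCM 14
(2011) Def. 1.1; Kim–Nakamura arXiv:1808.07726 Thm. 4.4 (the partner's upper half at additive `p`, not used here).
-/

-- D-0017: single-problem summit, so `Summit.BirchSwinnertonDyer.BirchSwinnertonDyer.…` repeats a namespace BY DESIGN.
set_option linter.dupNamespace false
set_option autoImplicit false

noncomputable section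

open scoped NumberField Classical

open NumberField WeierstrassCurve
  Literature.NumberTheory.EllipticCurves Literature.NumberTheory.EllipticCurves.Rank1Residual
  Literature.NumberTheory.EllipticCurves.Rank1Residual.Typed

namespace Summit.BirchSwinnertonDyer.BirchSwinnertonDyer.Theorems.AdditiveKoly.QuadraticDescent

/-- `#Ш_an ≠ 0` for an elliptic curve with entire `L`-function (the leading coefficient is non-zero and `#Ш_an · B = Λ`).
[folklore] -/
theorem analyticSha_ne_zero {F : Type} [Field F] [NumberField F] (V : WeierstrassCurve F) [V.IsElliptic]
    (hV : V.HasEntireLFunction) : analyticSha V ≠ 0 := by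
  have hΩ : (V.bsdPeriod : ℂ) ≠ 0 := by exact_mod_cast V.bsdPeriod_pos'.ne'
  have hc : (V.modifiedTamagawaProduct : ℂ) ≠ 0 := by exact_mod_cast (V.modifiedTamagawaProduct_pos).ne'
  have hR : (V.regulator : ℂ) ≠ 0 := by exact_mod_cast V.regulator_pos'.ne'
  have ht : (V.torsionOrder : ℂ) ≠ 0 := by exact_mod_cast V.torsionOrder_pos_holds.ne'
  rw [analyticSha_def]
  exact div_ne_zero (mul_ne_zero (V.leadingLCoeff_ne_zero_holds hV) (pow_ne_zero _ ht)) (mul_ne_zero (mul_ne_zero hΩ hc) hR)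

/-! ## §1 The product identity and the rationality descents -/

/-- **`#Ш_an(E_K) · r · #Ш(E)[p^∞] · #Ш(E^{(c)})[p^∞] = #Ш(E_K)[p^∞] · #Ш_an(E) · #Ш_an(E^{(c)})`, `r ∈ ℚˣ`, `ord_p r = 0`.**  For `W/ℚ`
globally minimal, `K = ℚ(θ₁)` quadratic with `θ₁² = c`, `Wc` a globally minimal model of `W^{(c)}`, `VK` any `K`-model of `W_K`,
`L(W)`, `L(Wc)` entire, `Ш(W)[p^∞]`, `Ш(Wc)[p^∞]` finite, GIVEN Dokchitser–Dokchitser 2010 Thm. 2.3 in Milne's form (`hDD`):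
`Ш(VK)[p^∞]` is finite and the displayed identity of complex numbers holds (the `BSD_p`-quotients multiply up to the `p`-unit
rational `r`, the leading coefficients multiply, and `#Ш_an · B = Λ` on each curve).  The computational core of the tree's
`padicValRat_analyticSha_quadratic`, isolated so that rationality can be moved in EITHER direction.
[cite: DokchitserDokchitserAnnals2010, §2.1 Thm. 2.3 (second clause) and its proof] [cite: IrelandRosen1990, Ch. 20 §5, Prop. 20.5.4(b)] -/
theorem analyticSha_baseChange_quadratic_mul (hDD : Milne1972.bsdQuotientP_baseChange_relQuadratic_anyModel)
    (W : WeierstrassCurve ℚ) [W.IsElliptic] [W.IsGloballyMinimal]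
    (K : Type) [Field K] [NumberField K] (h2 : Module.finrank ℚ K = 2)
    {c : ℚ} {θ₁ : K} (hθ₁ : θ₁ ^ 2 = algebraMap ℚ K c) (hθK : θ₁ ∉ Set.range (algebraMap ℚ K))
    (Wc : WeierstrassCurve ℚ) [Wc.IsElliptic] [Wc.IsGloballyMinimal]
    (hWc : ∃ C : WeierstrassCurve.VariableChange ℚ, C • W.quadraticTwist c = Wc)
    (VK : WeierstrassCurve K) [VK.IsElliptic]
    (hVK : ∃ C : WeierstrassCurve.VariableChange K, C • W.baseChange K = VK)
    (p : ℕ) [Fact p.Prime]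
    (hfW : Finite (AddCommGroup.primaryComponent W.sha p))
    (hfWc : Finite (AddCommGroup.primaryComponent Wc.sha p))
    (hW : W.HasEntireLFunction) (hWcL : Wc.HasEntireLFunction) :
    Finite (AddCommGroup.primaryComponent VK.sha p) ∧
    ∃ r : ℚ, r ≠ 0 ∧ padicValRat p r = 0 ∧
      analyticSha VK * (r : ℂ) * (Nat.card (AddCommGroup.primaryComponent W.sha p) : ℂ) *
          (Nat.card (AddCommGroup.primaryComponent Wc.sha p) : ℂ) =
        (Nat.card (AddCommGroup.primaryComponent VK.sha p) : ℂ) * (analyticSha W * analyticSha Wc) := by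
  have hc0 : c ≠ 0 := by
    rintro rfl
    rw [map_zero, pow_eq_zero_iff two_ne_zero] at hθ₁
    exact hθK ⟨0, by rw [map_zero, hθ₁]⟩
  haveI := W.isElliptic_quadraticTwist hc0
  haveI : (W.baseChange K).IsElliptic := by
    rw [WeierstrassCurve.baseChange]; infer_instance
  -- Dokchitser–Dokchitser / Milne for `K/ℚ` on the models `W`, `Wc`, `VK`
  obtain ⟨hfVK, r, hr0, hrp, hQ⟩ := hDD ℚ K h2 c θ₁ hθ₁ hθK W Wc hWc VK hVK p hfW hfWc
  refine ⟨hfVK, r, hr0, hrp, ?_⟩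
  -- the leading coefficients multiply, transported to the models
  obtain ⟨Cc, hCc⟩ := hWc
  obtain ⟨CK, hCK⟩ := hVK
  have hWcL' : (W.quadraticTwist c).HasEntireLFunction := by
    rw [← hasEntireLFunction_smul_iff _ Cc, hCc]; exact hWcL
  have hΛ : VK.leadingLCoeff = W.leadingLCoeff * Wc.leadingLCoeff := by
    rw [← hCK, ← hCc, leadingLCoeff_smul, leadingLCoeff_smul]
    exact W.leadingLCoeff_baseChange_relQuadratic K h2 hθ₁ hθK hW hWcL'
  -- the `BSD_p` identity (any-model currency on all three curves), cast to `ℂ`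
  set NVK := Nat.card (AddCommGroup.primaryComponent VK.sha p) with hNVK
  set NW := Nat.card (AddCommGroup.primaryComponent W.sha p) with hNW
  set NWc := Nat.card (AddCommGroup.primaryComponent Wc.sha p) with hNWc
  set bVK : ℝ := VK.regulator * VK.bsdPeriod * (VK.modifiedTamagawaProduct : ℝ) / (VK.torsionOrder : ℝ) ^ 2 with hbVK
  set bW : ℝ := W.regulator * W.bsdPeriod * (W.modifiedTamagawaProduct : ℝ) / (W.torsionOrder : ℝ) ^ 2 with hbW
  set bWc : ℝ := Wc.regulator * Wc.bsdPeriod * (Wc.modifiedTamagawaProduct : ℝ) / (Wc.torsionOrder : ℝ) ^ 2 with hbWc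
  have hQ' : (NVK : ℝ) * bVK = (r : ℝ) * ((NW : ℝ) * bW) * ((NWc : ℝ) * bWc) := by
    rw [hbVK, hbW, hbWc]
    linear_combination hQ
  have hQc : (NVK : ℂ) * (bVK : ℂ) = (r : ℂ) * ((NW : ℂ) * (bW : ℂ)) * ((NWc : ℂ) * (bWc : ℂ)) := by
    have := congrArg (fun x : ℝ => (x : ℂ)) hQ'
    push_cast at this
    exact_mod_cast this
  -- `#Ш_an · B = Λ` with `B = Reg·Ω·C/#tors² ≠ 0`, on any model over any number field (unfolding `analyticSha`)
  have key : ∀ (F : Type) [Field F] [NumberField F] (V : WeierstrassCurve F) [V.IsElliptic],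
      analyticSha V * ((V.regulator * V.bsdPeriod * (V.modifiedTamagawaProduct : ℝ) / (V.torsionOrder : ℝ) ^ 2 : ℝ) : ℂ) =
        V.leadingLCoeff ∧
      ((V.regulator * V.bsdPeriod * (V.modifiedTamagawaProduct : ℝ) / (V.torsionOrder : ℝ) ^ 2 : ℝ) : ℂ) ≠ 0 := by
    intro F _ _ V _
    have hΩ : (V.bsdPeriod : ℂ) ≠ 0 := by exact_mod_cast V.bsdPeriod_pos'.ne'
    have hc : (V.modifiedTamagawaProduct : ℂ) ≠ 0 := by exact_mod_cast (V.modifiedTamagawaProduct_pos).ne'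
    have hR : (V.regulator : ℂ) ≠ 0 := by exact_mod_cast V.regulator_pos'.ne'
    have ht : (V.torsionOrder : ℂ) ≠ 0 := by exact_mod_cast V.torsionOrder_pos_holds.ne'
    refine ⟨?_, ?_⟩
    · rw [analyticSha_def]
      push_cast
      field_simp
    · push_cast
      exact div_ne_zero (mul_ne_zero (mul_ne_zero hR hΩ) hc) (pow_ne_zero _ ht)
  obtain ⟨aVK, bVK0⟩ := key K VK
  obtain ⟨aW, bW0⟩ := key ℚ W
  obtain ⟨aWc, bWc0⟩ := key ℚ Wc
  have hb : (bVK : ℂ) * ((bW : ℂ) * (bWc : ℂ)) ≠ 0 := mul_ne_zero bVK0 (mul_ne_zero bW0 bWc0)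
  apply mul_right_cancel₀ hb
  calc analyticSha VK * (r : ℂ) * (NW : ℂ) * (NWc : ℂ) * ((bVK : ℂ) * ((bW : ℂ) * (bWc : ℂ)))
      = (analyticSha VK * (bVK : ℂ)) * ((r : ℂ) * ((NW : ℂ) * (bW : ℂ)) * ((NWc : ℂ) * (bWc : ℂ))) := by ring
    _ = VK.leadingLCoeff * ((NVK : ℂ) * (bVK : ℂ)) := by rw [aVK, hQc]
    _ = (NVK : ℂ) * ((analyticSha W * (bW : ℂ)) * (analyticSha Wc * (bWc : ℂ))) * (bVK : ℂ) := by
        rw [aW, aWc, hΛ]; ring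
    _ = (NVK : ℂ) * (analyticSha W * analyticSha Wc) * ((bVK : ℂ) * ((bW : ℂ) * (bWc : ℂ))) := by ring

/-- **Rationality descends from the base change and the twist to `E`.**  In the configuration of
`analyticSha_baseChange_quadratic_mul`: if `#Ш_an(VK)` and `#Ш_an(Wc)` (Miller's `shaAn`) are rational, so is `#Ш_an(W)` —
explicitly `qW = qK · r · #Ш(W)[p^∞] · #Ш(Wc)[p^∞] / (#Ш(VK)[p^∞] · qWc)`.  (An engine over an AUXILIARY quadratic field delivers
rationality over that field; the landing socket over `ℚ` needs it over `ℚ`.) [cite: DokchitserDokchitserAnnals2010, §2.1 Thm. 2.3]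
[cite: Miller2011LMS, §1 and Def. 1.1 (arXiv:1010.2431 p. 3)] -/
theorem exists_shaAn_eq_of_baseChange_of_twist (hDD : Milne1972.bsdQuotientP_baseChange_relQuadratic_anyModel)
    (W : WeierstrassCurve ℚ) [W.IsElliptic] [W.IsGloballyMinimal]
    (K : Type) [Field K] [NumberField K] (h2 : Module.finrank ℚ K = 2)
    {c : ℚ} {θ₁ : K} (hθ₁ : θ₁ ^ 2 = algebraMap ℚ K c) (hθK : θ₁ ∉ Set.range (algebraMap ℚ K))
    (Wc : WeierstrassCurve ℚ) [Wc.IsElliptic] [Wc.IsGloballyMinimal]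
    (hWc : ∃ C : WeierstrassCurve.VariableChange ℚ, C • W.quadraticTwist c = Wc)
    (VK : WeierstrassCurve K) [VK.IsElliptic]
    (hVK : ∃ C : WeierstrassCurve.VariableChange K, C • W.baseChange K = VK)
    (p : ℕ) [Fact p.Prime]
    (hfW : Finite (AddCommGroup.primaryComponent W.sha p))
    (hfWc : Finite (AddCommGroup.primaryComponent Wc.sha p))
    (hW : W.HasEntireLFunction) (hWcL : Wc.HasEntireLFunction)
    {qK qWc : ℚ} (hqK : analyticSha VK = (qK : ℂ)) (hqWc : shaAn Wc = (qWc : ℂ)) :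
    ∃ qW : ℚ, shaAn W = (qW : ℂ) := by
  obtain ⟨hfVK, r, hr0, -, hprod⟩ := analyticSha_baseChange_quadratic_mul hDD W K h2 hθ₁ hθK Wc hWc VK hVK p hfW hfWc hW hWcL
  rw [← analyticSha_eq_shaAn] at hqWc ⊢
  haveI := hfVK
  have hNVK0 : (Nat.card (AddCommGroup.primaryComponent VK.sha p) : ℂ) ≠ 0 := by
    exact_mod_cast (Nat.card_pos (α := AddCommGroup.primaryComponent VK.sha p)).ne'
  have hWc0 : analyticSha Wc ≠ 0 := analyticSha_ne_zero Wc hWcL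
  refine ⟨qK * r * Nat.card (AddCommGroup.primaryComponent W.sha p) * Nat.card (AddCommGroup.primaryComponent Wc.sha p) /
    (Nat.card (AddCommGroup.primaryComponent VK.sha p) * qWc), ?_⟩
  rw [hqK, hqWc] at hprod; rw [hqWc] at hWc0
  push_cast
  rw [eq_div_iff (mul_ne_zero hNVK0 hWc0)]
  linear_combination hprod.symm

/-- **Rationality descends from the base change and `E` to the twist** (roles of `W`, `Wc` swapped in
`exists_shaAn_eq_of_baseChange_of_twist`). [cite: DokchitserDokchitserAnnals2010, §2.1 Thm. 2.3]
[cite: Miller2011LMS, §1 and Def. 1.1 (arXiv:1010.2431 p. 3)] -/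
theorem exists_shaAn_twist_eq_of_baseChange (hDD : Milne1972.bsdQuotientP_baseChange_relQuadratic_anyModel)
    (W : WeierstrassCurve ℚ) [W.IsElliptic] [W.IsGloballyMinimal]
    (K : Type) [Field K] [NumberField K] (h2 : Module.finrank ℚ K = 2)
    {c : ℚ} {θ₁ : K} (hθ₁ : θ₁ ^ 2 = algebraMap ℚ K c) (hθK : θ₁ ∉ Set.range (algebraMap ℚ K))
    (Wc : WeierstrassCurve ℚ) [Wc.IsElliptic] [Wc.IsGloballyMinimal]
    (hWc : ∃ C : WeierstrassCurve.VariableChange ℚ, C • W.quadraticTwist c = Wc)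
    (VK : WeierstrassCurve K) [VK.IsElliptic]
    (hVK : ∃ C : WeierstrassCurve.VariableChange K, C • W.baseChange K = VK)
    (p : ℕ) [Fact p.Prime]
    (hfW : Finite (AddCommGroup.primaryComponent W.sha p))
    (hfWc : Finite (AddCommGroup.primaryComponent Wc.sha p))
    (hW : W.HasEntireLFunction) (hWcL : Wc.HasEntireLFunction)
    {qK qW : ℚ} (hqK : analyticSha VK = (qK : ℂ)) (hqW : shaAn W = (qW : ℂ)) :
    ∃ qWc : ℚ, shaAn Wc = (qWc : ℂ) := by
  obtain ⟨hfVK, r, hr0, -, hprod⟩ := analyticSha_baseChange_quadratic_mul hDD W K h2 hθ₁ hθK Wc hWc VK hVK p hfW hfWc hW hWcL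
  rw [← analyticSha_eq_shaAn] at hqW ⊢
  haveI := hfVK
  have hNVK0 : (Nat.card (AddCommGroup.primaryComponent VK.sha p) : ℂ) ≠ 0 := by
    exact_mod_cast (Nat.card_pos (α := AddCommGroup.primaryComponent VK.sha p)).ne'
  have hW0 : analyticSha W ≠ 0 := analyticSha_ne_zero W hW
  refine ⟨qK * r * Nat.card (AddCommGroup.primaryComponent W.sha p) * Nat.card (AddCommGroup.primaryComponent Wc.sha p) /
    (Nat.card (AddCommGroup.primaryComponent VK.sha p) * qW), ?_⟩
  rw [hqK, hqW] at hprod; rw [hqW] at hW0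
  push_cast
  rw [eq_div_iff (mul_ne_zero hNVK0 hW0)]
  linear_combination hprod.symm

/-! ## §2 `δ_p(E_K) = δ_p(E) + δ_p(E^{(c)})` and the one-sided descent in the `Ш[p^∞]` currency -/

/-- **`δ_p(E_K/K) = δ_p(E) + δ_p(E^{(c)})`**, `δ_p(X) = ord_p #Ш_an(X) − ord_p #Ш(X)[p^∞]`, for ANY rational values `qK, qW, qWc` of
the three analytic orders of `Ш` (configuration of `analyticSha_baseChange_quadratic_mul`).  The one-layer Artin–Milne bookkeeping
(the tree's `SolventPairLowerBound.padicValRat_analyticSha_quadratic` computes `qK` from `qW, qWc`; here all three are given).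
[cite: DokchitserDokchitserAnnals2010, §2.1 Thm. 2.3 (second clause) and its proof] [cite: Miller2011LMS, §1 and Def. 1.1 (arXiv:1010.2431 p. 3)] -/
theorem padicValRat_delta_quadratic (hDD : Milne1972.bsdQuotientP_baseChange_relQuadratic_anyModel)
    (W : WeierstrassCurve ℚ) [W.IsElliptic] [W.IsGloballyMinimal]
    (K : Type) [Field K] [NumberField K] (h2 : Module.finrank ℚ K = 2)
    {c : ℚ} {θ₁ : K} (hθ₁ : θ₁ ^ 2 = algebraMap ℚ K c) (hθK : θ₁ ∉ Set.range (algebraMap ℚ K))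
    (Wc : WeierstrassCurve ℚ) [Wc.IsElliptic] [Wc.IsGloballyMinimal]
    (hWc : ∃ C : WeierstrassCurve.VariableChange ℚ, C • W.quadraticTwist c = Wc)
    (VK : WeierstrassCurve K) [VK.IsElliptic]
    (hVK : ∃ C : WeierstrassCurve.VariableChange K, C • W.baseChange K = VK)
    (p : ℕ) [Fact p.Prime]
    (hfW : Finite (AddCommGroup.primaryComponent W.sha p))
    (hfWc : Finite (AddCommGroup.primaryComponent Wc.sha p))
    (hW : W.HasEntireLFunction) (hWcL : Wc.HasEntireLFunction)
    {qK qW qWc : ℚ} (hqK : analyticSha VK = (qK : ℂ)) (hqW : shaAn W = (qW : ℂ)) (hqWc : shaAn Wc = (qWc : ℂ)) :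
    padicValRat p qK - padicValNat p (Nat.card (AddCommGroup.primaryComponent VK.sha p)) =
      (padicValRat p qW - padicValNat p (Nat.card (AddCommGroup.primaryComponent W.sha p))) +
      (padicValRat p qWc - padicValNat p (Nat.card (AddCommGroup.primaryComponent Wc.sha p))) := by
  obtain ⟨hfVK, r, hr0, hrp, hprod⟩ := analyticSha_baseChange_quadratic_mul hDD W K h2 hθ₁ hθK Wc hWc VK hVK p hfW hfWc hW hWcL
  rw [← analyticSha_eq_shaAn] at hqW hqWc
  have hqW0 : qW ≠ 0 := by intro h; apply analyticSha_ne_zero W hW; rw [hqW, h, Rat.cast_zero]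
  have hqWc0 : qWc ≠ 0 := by intro h; apply analyticSha_ne_zero Wc hWcL; rw [hqWc, h, Rat.cast_zero]
  haveI := hfVK; haveI := hfW; haveI := hfWc
  set NVK := Nat.card (AddCommGroup.primaryComponent VK.sha p) with hNVK
  set NW := Nat.card (AddCommGroup.primaryComponent W.sha p) with hNW
  set NWc := Nat.card (AddCommGroup.primaryComponent Wc.sha p) with hNWc
  have hNVK0 : NVK ≠ 0 := Nat.card_pos.ne'
  have hNW0 : NW ≠ 0 := Nat.card_pos.ne'
  have hNWc0 : NWc ≠ 0 := Nat.card_pos.ne'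
  rw [hqK, hqW, hqWc] at hprod
  have hQ : qK * r * NW * NWc = NVK * (qW * qWc) := by exact_mod_cast hprod
  have hqK0 : qK ≠ 0 := by
    intro h
    rw [h, zero_mul, zero_mul, zero_mul] at hQ
    exact mul_ne_zero (by exact_mod_cast hNVK0) (mul_ne_zero hqW0 hqWc0) hQ.symm
  have hv := congrArg (padicValRat p) hQ
  rw [padicValRat.mul (mul_ne_zero (mul_ne_zero hqK0 hr0) (by exact_mod_cast hNW0)) (by exact_mod_cast hNWc0),
    padicValRat.mul (mul_ne_zero hqK0 hr0) (by exact_mod_cast hNW0), padicValRat.mul hqK0 hr0,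
    padicValRat.mul (by exact_mod_cast hNVK0) (mul_ne_zero hqW0 hqWc0), padicValRat.mul hqW0 hqWc0, hrp,
    padicValRat.of_nat, padicValRat.of_nat, padicValRat.of_nat] at hv
  linarith

/-- **LOWER over `K` + UPPER for the twist ⟹ LOWER for `E`.**  In the configuration of `analyticSha_baseChange_quadratic_mul`,
if `#Ш_an(VK)` is a rational `qK` with `ord_p qK ≤ ord_p #Ш(VK)[p^∞]` (the one-sided, «Eisenstein» `p`-part of BSD for `E` over
the quadratic field `K` — e.g. an anticyclotomic main-conjecture divisibility over an AUXILIARY imaginary quadratic field) and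
`#Ш_an(Wc)` is a rational `qWc` with `ord_p #Ш(Wc)[p^∞] ≤ ord_p qWc` (the «Euler-system ∕ Kato» half for the partner twist over `ℚ`),
then `#Ш_an(W)` is a rational `qW` with `ord_p qW ≤ ord_p #Ш(W)[p^∞]`.  Proof: rationality descends (§1) and
`δ_p(VK) = δ_p(W) + δ_p(Wc)` (`padicValRat_analyticSha_quadratic`) with `δ_p(VK) ≤ 0 ≤ δ_p(Wc)`.
[cite: DokchitserDokchitserAnnals2010, §2.1 Thm. 2.3] [cite: Miller2011LMS, Def. 1.1 (arXiv:1010.2431 p. 3)] -/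
theorem padicValRat_shaAn_le_of_lowerBaseChange_of_upperTwist
    (hDD : Milne1972.bsdQuotientP_baseChange_relQuadratic_anyModel)
    (W : WeierstrassCurve ℚ) [W.IsElliptic] [W.IsGloballyMinimal]
    (K : Type) [Field K] [NumberField K] (h2 : Module.finrank ℚ K = 2)
    {c : ℚ} {θ₁ : K} (hθ₁ : θ₁ ^ 2 = algebraMap ℚ K c) (hθK : θ₁ ∉ Set.range (algebraMap ℚ K))
    (Wc : WeierstrassCurve ℚ) [Wc.IsElliptic] [Wc.IsGloballyMinimal]
    (hWc : ∃ C : WeierstrassCurve.VariableChange ℚ, C • W.quadraticTwist c = Wc)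
    (VK : WeierstrassCurve K) [VK.IsElliptic]
    (hVK : ∃ C : WeierstrassCurve.VariableChange K, C • W.baseChange K = VK)
    (p : ℕ) [Fact p.Prime]
    (hfW : Finite (AddCommGroup.primaryComponent W.sha p))
    (hfWc : Finite (AddCommGroup.primaryComponent Wc.sha p))
    (hW : W.HasEntireLFunction) (hWcL : Wc.HasEntireLFunction)
    (hKlow : ∃ qK : ℚ, analyticSha VK = (qK : ℂ) ∧
      padicValRat p qK ≤ padicValNat p (Nat.card (AddCommGroup.primaryComponent VK.sha p)))
    (hcUp : ∃ qWc : ℚ, shaAn Wc = (qWc : ℂ) ∧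
      (padicValNat p (Nat.card (AddCommGroup.primaryComponent Wc.sha p)) : ℤ) ≤ padicValRat p qWc) :
    ∃ qW : ℚ, shaAn W = (qW : ℂ) ∧
      padicValRat p qW ≤ padicValNat p (Nat.card (AddCommGroup.primaryComponent W.sha p)) := by
  obtain ⟨qK, hqK, hKle⟩ := hKlow
  obtain ⟨qWc, hqWc, hcle⟩ := hcUp
  obtain ⟨qW, hqW⟩ := exists_shaAn_eq_of_baseChange_of_twist hDD W K h2 hθ₁ hθK Wc hWc VK hVK p hfW hfWc hW hWcL hqK hqWc
  have hδ := padicValRat_delta_quadratic hDD W K h2 hθ₁ hθK Wc hWc VK hVK p hfW hfWc hW hWcL hqK hqW hqWc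
  exact ⟨qW, hqW, by linarith⟩

/-- **LOWER over `K` + UPPER for `E` ⟹ LOWER for the twist** (roles swapped). [cite: DokchitserDokchitserAnnals2010, §2.1 Thm. 2.3]
[cite: Miller2011LMS, Def. 1.1 (arXiv:1010.2431 p. 3)] -/
theorem padicValRat_shaAn_twist_le_of_lowerBaseChange_of_upper
    (hDD : Milne1972.bsdQuotientP_baseChange_relQuadratic_anyModel)
    (W : WeierstrassCurve ℚ) [W.IsElliptic] [W.IsGloballyMinimal]
    (K : Type) [Field K] [NumberField K] (h2 : Module.finrank ℚ K = 2)
    {c : ℚ} {θ₁ : K} (hθ₁ : θ₁ ^ 2 = algebraMap ℚ K c) (hθK : θ₁ ∉ Set.range (algebraMap ℚ K))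
    (Wc : WeierstrassCurve ℚ) [Wc.IsElliptic] [Wc.IsGloballyMinimal]
    (hWc : ∃ C : WeierstrassCurve.VariableChange ℚ, C • W.quadraticTwist c = Wc)
    (VK : WeierstrassCurve K) [VK.IsElliptic]
    (hVK : ∃ C : WeierstrassCurve.VariableChange K, C • W.baseChange K = VK)
    (p : ℕ) [Fact p.Prime]
    (hfW : Finite (AddCommGroup.primaryComponent W.sha p))
    (hfWc : Finite (AddCommGroup.primaryComponent Wc.sha p))
    (hW : W.HasEntireLFunction) (hWcL : Wc.HasEntireLFunction)
    (hKlow : ∃ qK : ℚ, analyticSha VK = (qK : ℂ) ∧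
      padicValRat p qK ≤ padicValNat p (Nat.card (AddCommGroup.primaryComponent VK.sha p)))
    (hUp : ∃ qW : ℚ, shaAn W = (qW : ℂ) ∧
      (padicValNat p (Nat.card (AddCommGroup.primaryComponent W.sha p)) : ℤ) ≤ padicValRat p qW) :
    ∃ qWc : ℚ, shaAn Wc = (qWc : ℂ) ∧
      padicValRat p qWc ≤ padicValNat p (Nat.card (AddCommGroup.primaryComponent Wc.sha p)) := by
  obtain ⟨qK, hqK, hKle⟩ := hKlow
  obtain ⟨qW, hqW, hle⟩ := hUp
  obtain ⟨qWc, hqWc⟩ := exists_shaAn_twist_eq_of_baseChange hDD W K h2 hθ₁ hθK Wc hWc VK hVK p hfW hfWc hW hWcL hqK hqW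
  have hδ := padicValRat_delta_quadratic hDD W K h2 hθ₁ hθK Wc hWc VK hVK p hfW hfWc hW hWcL hqK hqW hqWc
  exact ⟨qWc, hqWc, by linarith⟩

/-! ## §3 Miller's currency: `Typed.MissingLowerBoundAt` from the lower half over `K` and `Typed.MissingUpperBoundAt` of the partner -/

/-- **The Eisenstein half of `BSD(E,p)` over `ℚ` from an auxiliary quadratic field** (Miller's currency, full orders `#Ш`).  For
`W/ℚ` globally minimal with `Ш(W)` FINITE, `K = ℚ(θ₁)` quadratic (`θ₁² = c`), `Wc` a globally minimal model of `W^{(c)}` with `Ш(Wc)`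
finite, `VK` any `K`-model of `W_K`, `L(W)`, `L(Wc)` entire, GIVEN `hDD`: the LOWER half over `K` («`#Ш_an(VK) = qK ∈ ℚ`,
`ord_p qK ≤ ord_p #Ш(VK)[p^∞]`») and the UPPER half `Typed.MissingUpperBoundAt Wc p` for the partner give
`Typed.MissingLowerBoundAt W p` — the hypothesis `hlow` ∕ `hlowTw` of `AdditiveKoly.exists_kolyvaginClass_ne_zero_of_lowerHalves`
(the over-`ℚ` landing socket of the Eisenstein engines on the Kolyvagin cruxes).  `ord_p #Ш = ord_p #Ш[p^∞]` for finite `Ш`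
(`padicValNat_card_addPrimaryComponent`). [cite: Miller2011LMS, Def. 1.1 (arXiv:1010.2431 p. 3)]
[cite: DokchitserDokchitserAnnals2010, §2.1 Thm. 2.3] -/
theorem missingLowerBoundAt_of_lowerBaseChange_of_missingUpperBoundAt_twist
    (hDD : Milne1972.bsdQuotientP_baseChange_relQuadratic_anyModel)
    (W : WeierstrassCurve ℚ) [W.IsElliptic] [W.IsGloballyMinimal]
    (K : Type) [Field K] [NumberField K] (h2 : Module.finrank ℚ K = 2)
    {c : ℚ} {θ₁ : K} (hθ₁ : θ₁ ^ 2 = algebraMap ℚ K c) (hθK : θ₁ ∉ Set.range (algebraMap ℚ K))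
    (Wc : WeierstrassCurve ℚ) [Wc.IsElliptic] [Wc.IsGloballyMinimal]
    (hWc : ∃ C : WeierstrassCurve.VariableChange ℚ, C • W.quadraticTwist c = Wc)
    (VK : WeierstrassCurve K) [VK.IsElliptic]
    (hVK : ∃ C : WeierstrassCurve.VariableChange K, C • W.baseChange K = VK)
    (p : ℕ) [Fact p.Prime] (hWfin : W.ShaFinite) (hWcfin : Wc.ShaFinite)
    (hW : W.HasEntireLFunction) (hWcL : Wc.HasEntireLFunction)
    (hKlow : ∃ qK : ℚ, analyticSha VK = (qK : ℂ) ∧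
      padicValRat p qK ≤ padicValNat p (Nat.card (AddCommGroup.primaryComponent VK.sha p)))
    (hcUp : MissingUpperBoundAt Wc p) :
    MissingLowerBoundAt W p := by
  haveI : Finite W.sha := hWfin
  haveI : Finite Wc.sha := hWcfin
  obtain ⟨qWc, hqWc, hcle⟩ := hcUp
  have hcUp' : ∃ qWc : ℚ, shaAn Wc = (qWc : ℂ) ∧
      (padicValNat p (Nat.card (AddCommGroup.primaryComponent Wc.sha p)) : ℤ) ≤ padicValRat p qWc :=
    ⟨qWc, hqWc, by rwa [padicValNat_card_addPrimaryComponent (A := Wc.sha) p]⟩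
  obtain ⟨qW, hqW, hle⟩ := padicValRat_shaAn_le_of_lowerBaseChange_of_upperTwist hDD W K h2 hθ₁ hθK Wc hWc VK hVK p
    inferInstance inferInstance hW hWcL hKlow hcUp'
  refine ⟨qW, hqW, ?_⟩
  rwa [padicValNat_card_addPrimaryComponent (A := W.sha) p] at hle

/-- **The Eisenstein half for the TWIST from an auxiliary quadratic field** (roles swapped): LOWER over `K` and
`Typed.MissingUpperBoundAt W p` give `Typed.MissingLowerBoundAt Wc p`. [cite: Miller2011LMS, Def. 1.1 (arXiv:1010.2431 p. 3)]
[cite: DokchitserDokchitserAnnals2010, §2.1 Thm. 2.3] -/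
theorem missingLowerBoundAt_twist_of_lowerBaseChange_of_missingUpperBoundAt
    (hDD : Milne1972.bsdQuotientP_baseChange_relQuadratic_anyModel)
    (W : WeierstrassCurve ℚ) [W.IsElliptic] [W.IsGloballyMinimal]
    (K : Type) [Field K] [NumberField K] (h2 : Module.finrank ℚ K = 2)
    {c : ℚ} {θ₁ : K} (hθ₁ : θ₁ ^ 2 = algebraMap ℚ K c) (hθK : θ₁ ∉ Set.range (algebraMap ℚ K))
    (Wc : WeierstrassCurve ℚ) [Wc.IsElliptic] [Wc.IsGloballyMinimal]
    (hWc : ∃ C : WeierstrassCurve.VariableChange ℚ, C • W.quadraticTwist c = Wc)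
    (VK : WeierstrassCurve K) [VK.IsElliptic]
    (hVK : ∃ C : WeierstrassCurve.VariableChange K, C • W.baseChange K = VK)
    (p : ℕ) [Fact p.Prime] (hWfin : W.ShaFinite) (hWcfin : Wc.ShaFinite)
    (hW : W.HasEntireLFunction) (hWcL : Wc.HasEntireLFunction)
    (hKlow : ∃ qK : ℚ, analyticSha VK = (qK : ℂ) ∧
      padicValRat p qK ≤ padicValNat p (Nat.card (AddCommGroup.primaryComponent VK.sha p)))
    (hUp : MissingUpperBoundAt W p) :
    MissingLowerBoundAt Wc p := by
  haveI : Finite W.sha := hWfin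
  haveI : Finite Wc.sha := hWcfin
  obtain ⟨qW, hqW, hle⟩ := hUp
  have hUp' : ∃ qW : ℚ, shaAn W = (qW : ℂ) ∧
      (padicValNat p (Nat.card (AddCommGroup.primaryComponent W.sha p)) : ℤ) ≤ padicValRat p qW :=
    ⟨qW, hqW, by rwa [padicValNat_card_addPrimaryComponent (A := W.sha) p]⟩
  obtain ⟨qWc, hqWc, hcle⟩ := padicValRat_shaAn_twist_le_of_lowerBaseChange_of_upper hDD W K h2 hθ₁ hθK Wc hWc VK hVK p
    inferInstance inferInstance hW hWcL hKlow hUp'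
  refine ⟨qWc, hqWc, ?_⟩
  rwa [padicValNat_card_addPrimaryComponent (A := Wc.sha) p] at hcle

end Summit.BirchSwinnertonDyer.BirchSwinnertonDyer.Theorems.AdditiveKoly.QuadraticDescent

end
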